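import Literature.Analysis.FluidPDE.CompressibleEulerImplosionShooting
import Literature.Analysis.FluidPDE.CompressibleEulerImplosionShootingM
import Literature.Analysis.FluidPDE.CompressibleEulerImplosionRightL
import Literature.Analysis.FluidPDE.CompressibleEulerImplosionShootingN
import HarnessLib

/-!
# Buckmaster–Cao-Labora–Gómez-Serrano at γ = 5/3: the shooting argument on the window `[13890041/12500000, 697/625]`

Re-instantiation of `CompressibleEulerImplosionShooting` (§6 of the paper at `γ = 5/3`) on a window pinned at BOTH
ends by generated right barriers: left end `r_L = 13890041/12500000 = 1.11120328` (`CompressibleEulerImplosionRightL`,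
of `RightD` type; its far-field anchor `W ≥ 1407/50` is reached thanks to `ShootingN.germ_anchor_far`), right end
`697/625` (`CompressibleEulerImplosionRightM`, of `RightU` type). `e(697/625) < 0 < e(r_L)` by the two barriers, `e`
is continuous (tube estimate, verbatim from the original file), so the `P₀` trajectory MEETS the branch through `P_s`
for some `r ∈ [r_L, 697/625]` (`exists_meetingL`), a window of width `4.0·10⁻³` around the meeting parameter.

[cite: BuckmasterCaolaboraGomezserrano2025, §6 (proof of Theorem 1.1), Prop. 4.1, Prop. 2.5, Prop. 3.1]
-/

noncomputable section

open Set Filter Topology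

namespace Literature.Analysis.FluidPDE

namespace BuckmasterCaolaboraGomezserrano2025

namespace Monatomic

namespace ShootingL

open SonicSeries Germ Tube OriginSeries

/-! ### The window `[13890041/12500000, 697/625]` -/

/-- [folklore] -/
theorem rlo_eq : RightL.rL = 13890041 / 12500000 := rfl

/-- [folklore] -/
theorem rlo_le_rhi : RightL.rL ≤ RightM.rM := by rw [rlo_eq, ShootingM.rhi_eq]; norm_num

/-- [folklore] -/
theorem r3_lt_rlo : r3 < RightL.rL := RightL.ru_mem.1

/-- [folklore] -/
theorem rd_le_rlo : Shooting.rd ≤ RightL.rL := by rw [Shooting.rd_eq, rlo_eq]; norm_num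

/-- The window sits inside the original one. [folklore] -/
theorem mem_window_of {r : ℝ} (hr : r ∈ Icc RightL.rL RightM.rM) : r ∈ Icc Shooting.rd Shooting.ru :=
  ⟨rd_le_rlo.trans hr.1, hr.2.trans ShootingM.rhi_lt_ru.le⟩

/-- [folklore] -/
theorem windowL {r : ℝ} (hr : r ∈ Icc RightL.rL RightM.rM) :
    11 / 10 ≤ r ∧ r ≤ 28 / 25 ∧ r3 < r ∧ r < r4 ∧ |r| ≤ 2 :=
  Shooting.window (mem_window_of hr)

variable {r : ℝ}

/-- **Choice of the branch time `s < 0`**, uniformly good on the window and below the thresholds of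
the two right barriers. [cite: BuckmasterCaolaboraGomezserrano2025, §6] -/
theorem exists_sL : ∃ s : ℝ, s < 0 ∧
    (∀ r ∈ Icc RightL.rL RightM.rM, |s| < sonicRad r ∧
      (∀ t : ℝ, s ≤ t → t < 0 → 0 < DW (Wloc r t) (Zloc r t) ∧ DZ (Wloc r t) (Zloc r t) < 0 ∧
        Zloc r t < Wloc r t ∧ W0 r < Wloc r t ∧ |Wloc r t - W0 r| ≤ 1 / 4)) ∧
    ContinuousOn (fun r => Wloc r s) (Icc RightL.rL RightM.rM) ∧ ContinuousOn (fun r => Zloc r s) (Icc RightL.rL RightM.rM) ∧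
    RightM.barM (Wloc RightM.rM s) < Zloc RightM.rM s ∧ Zloc RightL.rL s < RightL.barL (Wloc RightL.rL s) := by
  obtain ⟨δ, hδ, hbr⟩ := branch_uniform r3_lt_rlo ShootingM.rhi_lt_r4 rlo_le_rhi
  obtain ⟨ρ, hρ, hρle, hcW, hcZ⟩ := continuousOn_Wloc_Zloc r3_lt_rlo ShootingM.rhi_lt_r4 rlo_le_rhi
  obtain ⟨εu, hεu, hu⟩ := Metric.eventually_nhds_iff.mp (eventually_nhdsWithin_iff.mp RightM.branch_vs_bar)
  obtain ⟨εd, hεd, hd⟩ := Metric.eventually_nhds_iff.mp (eventually_nhdsWithin_iff.mp RightL.branch_vs_bar)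
  set σ : ℝ := min (min δ (ρ / 2)) (min (εu / 2) (εd / 2)) with hσ
  have hσpos : 0 < σ := by positivity
  have hσδ : σ ≤ δ := (min_le_left _ _).trans (min_le_left _ _)
  have hσρ : σ < ρ := lt_of_le_of_lt ((min_le_left _ _).trans (min_le_right _ _)) (by linarith)
  have hσu : σ < εu := lt_of_le_of_lt ((min_le_right _ _).trans (min_le_left _ _)) (by linarith)
  have hσd : σ < εd := lt_of_le_of_lt ((min_le_right _ _).trans (min_le_right _ _)) (by linarith)
  refine ⟨-σ, by linarith, fun r hr => ⟨?_, fun t ht1 ht2 => ?_⟩, ?_, ?_, ?_, ?_⟩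
  · rw [abs_neg, abs_of_pos hσpos]
    exact lt_of_le_of_lt hσδ (hbr r hr).1
  · have hta : |t| ≤ δ := by rw [abs_of_neg ht2]; linarith
    obtain ⟨⟨kDW, kZW, kW, _⟩, kneg, _⟩ := (hbr r hr).2 t hta
    exact ⟨kDW, (kneg ht2).1, kZW, (kneg ht2).2, kW⟩
  · refine hcW.comp (continuousOn_id.prodMk continuousOn_const) fun r hr => ⟨hr, ?_⟩
    simp only [Metric.mem_ball, dist_zero_right, norm_neg, Real.norm_eq_abs, abs_of_pos hσpos]
    exact hσρ
  · refine hcZ.comp (continuousOn_id.prodMk continuousOn_const) fun r hr => ⟨hr, ?_⟩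
    simp only [Metric.mem_ball, dist_zero_right, norm_neg, Real.norm_eq_abs, abs_of_pos hσpos]
    exact hσρ
  · exact hu (by rw [dist_zero_right, norm_neg, Real.norm_eq_abs, abs_of_pos hσpos]; exact hσu)
      (by show -σ < 0; linarith)
  · exact hd (by rw [dist_zero_right, norm_neg, Real.norm_eq_abs, abs_of_pos hσpos]; exact hσd)
      (by show -σ < 0; linarith)

/-- The branch time of the comparison. [cite: BuckmasterCaolaboraGomezserrano2025, §6] -/
def sL : ℝ := Classical.choose exists_sL

/-- [cite: BuckmasterCaolaboraGomezserrano2025, §6] -/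
theorem sL_spec : sL < 0 ∧
    (∀ r ∈ Icc RightL.rL RightM.rM, |sL| < sonicRad r ∧
      (∀ t : ℝ, sL ≤ t → t < 0 → 0 < DW (Wloc r t) (Zloc r t) ∧ DZ (Wloc r t) (Zloc r t) < 0 ∧
        Zloc r t < Wloc r t ∧ W0 r < Wloc r t ∧ |Wloc r t - W0 r| ≤ 1 / 4)) ∧
    ContinuousOn (fun r => Wloc r sL) (Icc RightL.rL RightM.rM) ∧ ContinuousOn (fun r => Zloc r sL) (Icc RightL.rL RightM.rM) ∧
    RightM.barM (Wloc RightM.rM sL) < Zloc RightM.rM sL ∧ Zloc RightL.rL sL < RightL.barL (Wloc RightL.rL sL) :=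
  Classical.choose_spec exists_sL

/-- The comparison abscissa `W* = W^{(r)}(s₀)` lies in `(W₀, 3)`. [folklore] -/
theorem Wstar_boundsL (hr : r ∈ Icc RightL.rL RightM.rM) : W0 r < Wloc r sL ∧ Wloc r sL < 3 := by
  obtain ⟨hs, hall, _⟩ := sL_spec
  obtain ⟨_, h⟩ := hall r hr
  obtain ⟨_, _, _, hW0, hW⟩ := h sL le_rfl hs
  obtain ⟨h1, h2, _, h4, _⟩ := windowL hr
  have hq := Germ.q_le h1 h2
  have hab := (abs_le.mp hW).2
  refine ⟨hW0, ?_⟩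
  unfold W0 at hab
  linarith

/-- **Existence of the crossing**: the `P₀` trajectory reaches the abscissa `W*` at some time in
`(ξ_A − 1, b)`. [cite: BuckmasterCaolaboraGomezserrano2025, §6] -/
theorem exists_crossingL (hr : r ∈ Icc RightL.rL RightM.rM) :
    ∃ θL : ℝ, ξA - 1 < θL ∧ θL < Shooting.bT r ∧ (Shooting.traj r θL).1 = Wloc r sL := by
  obtain ⟨h1, h2, _⟩ := windowL hr
  obtain ⟨hab, hgerm, hode, _, _, hanti, htend⟩ := Shooting.traj_spec h1 h2
  obtain ⟨hW0, hW3⟩ := Wstar_boundsL hr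
  set a := ξA - 1 with ha
  have hWa : 20 ≤ (Shooting.traj r a).1 := by rw [hgerm a le_rfl]; exact (germ_anchor h1 h2).1
  -- a time close to `b` where `W < W*`
  have hWt : Tendsto (fun u => (Shooting.traj r u).1) (𝓝[<] (Shooting.bT r)) (𝓝 (W0 r)) :=
    (continuous_fst.tendsto _).comp htend
  have hev : ∀ᶠ u in 𝓝[<] (Shooting.bT r), (Shooting.traj r u).1 < Wloc r sL := hWt (Iio_mem_nhds hW0)
  obtain ⟨ξ', ⟨hξ'lt, haξ'⟩⟩ := (hev.and (Ioo_mem_nhdsLT hab)).exists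
  -- IVT on `[a, ξ']`
  have hcont : ContinuousOn (fun u => (Shooting.traj r u).1) (Icc a ξ') := fun u hu =>
    ((hode u (lt_of_le_of_lt hu.2 haξ'.2)).continuousAt.fst).continuousWithinAt
  have hmem : Wloc r sL ∈ Icc ((Shooting.traj r ξ').1) ((Shooting.traj r a).1) := ⟨hξ'lt.le, by linarith⟩
  obtain ⟨θL, hθ, hθW⟩ := intermediate_value_Icc' haξ'.1.le hcont hmem
  refine ⟨θL, ?_, lt_of_le_of_lt hθ.2 haξ'.2, hθW⟩
  rcases eq_or_lt_of_le hθ.1 with h | h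
  · exfalso; rw [← h] at hθW; simp only at hθW; linarith
  · exact h

/-- The crossing time. [cite: BuckmasterCaolaboraGomezserrano2025, §6] -/
def θL (r : ℝ) : ℝ := if h : r ∈ Icc RightL.rL RightM.rM then Classical.choose (exists_crossingL h) else 0

/-- [cite: BuckmasterCaolaboraGomezserrano2025, §6] -/
theorem θL_spec (hr : r ∈ Icc RightL.rL RightM.rM) : ξA - 1 < θL r ∧ θL r < Shooting.bT r ∧ (Shooting.traj r (θL r)).1 = Wloc r sL := by
  simp only [θL, dif_pos hr]
  exact Classical.choose_spec (exists_crossingL hr)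

/-- Uniqueness of the crossing time. [folklore] -/
theorem eq_θL (hr : r ∈ Icc RightL.rL RightM.rM) {t : ℝ} (ht : t < Shooting.bT r) (hW : (Shooting.traj r t).1 = Wloc r sL) : t = θL r := by
  obtain ⟨h1, h2, _⟩ := windowL hr
  obtain ⟨_, hθb, hθW⟩ := θL_spec hr
  have hanti := (Shooting.traj_spec h1 h2).2.2.2.2.2.1
  exact hanti.injOn ht hθb (hW.trans hθW.symm)

/-- **The shooting function** `e(r) = Z_traj(θL(r)) − Z^{(r)}(s₀)`. [cite: BuckmasterCaolaboraGomezserrano2025, §6] -/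
def eL (r : ℝ) : ℝ := (Shooting.traj r (θL r)).2 - Zloc r sL

/-- [folklore] -/
theorem rhi_mem_window : RightM.rM ∈ Icc RightL.rL RightM.rM := ⟨rlo_le_rhi, le_rfl⟩

/-- [folklore] -/
theorem rlo_mem_window : RightL.rL ∈ Icc RightL.rL RightM.rM := ⟨le_rfl, rlo_le_rhi⟩

/-- **`e(697/625) < 0`**: at the right end the `P₀` trajectory passes below the branch.
[cite: BuckmasterCaolaboraGomezserrano2025, Prop. 4.1, §6] -/
theorem eL_rhi_neg : eL RightM.rM < 0 := by
  have hr := rhi_mem_window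
  obtain ⟨h1, h2, _⟩ := windowL hr
  obtain ⟨hab, hgerm, hode, hΩ, _, hanti, _⟩ := Shooting.traj_spec h1 h2
  obtain ⟨haθ, hθb, hθW⟩ := θL_spec hr
  obtain ⟨hWa, hDZa, _⟩ := germ_anchor h1 h2
  set a := ξA - 1 with ha
  -- the barrier on `[a, T']`, `T' ∈ (θL, b)`
  obtain ⟨T', hθT', hT'b⟩ := exists_between hθb
  have key := RightM.barrier (c := Shooting.traj RightM.rM) (a := a) (T := T')
    (fun ξ hξ => hode ξ (lt_trans hξ.2 hT'b))
    (fun ξ hξ => ⟨(hΩ ξ (lt_trans hξ.2 hT'b)).1, (hΩ ξ (lt_trans hξ.2 hT'b)).2.1⟩)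
    (fun ξ hξ => Shooting.W0_lt_traj h1 h2 (lt_trans hξ.2 hT'b))
    (by rw [hgerm a le_rfl]; exact RightM.below_of_far (by linarith [ShootingN.germ_anchor_far h1 h2]) hDZa)
    (θL RightM.rM) ⟨haθ.le, hθT'⟩
  rw [hθW] at key
  have hb := sL_spec.2.2.2.2.1
  show (Shooting.traj RightM.rM (θL RightM.rM)).2 - Zloc RightM.rM sL < 0
  linarith

/-- **`e(r_L) > 0`**: at the left end the `P₀` trajectory passes above the branch.
[cite: BuckmasterCaolaboraGomezserrano2025, Prop. 4.1, §6] -/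
theorem eL_rlo_pos : 0 < eL RightL.rL := by
  have hr := rlo_mem_window
  obtain ⟨h1, h2, _⟩ := windowL hr
  obtain ⟨hab, hgerm, hode, hΩ, _, hanti, _⟩ := Shooting.traj_spec h1 h2
  obtain ⟨haθ, hθb, hθW⟩ := θL_spec hr
  obtain ⟨hWa, _, hDWa⟩ := germ_anchor h1 h2
  set a := ξA - 1 with ha
  obtain ⟨T', hθT', hT'b⟩ := exists_between hθb
  have key := RightL.barrier (c := Shooting.traj RightL.rL) (a := a) (T := T')
    (fun ξ hξ => hode ξ (lt_trans hξ.2 hT'b))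
    (fun ξ hξ => ⟨(hΩ ξ (lt_trans hξ.2 hT'b)).1, (hΩ ξ (lt_trans hξ.2 hT'b)).2.1⟩)
    (fun ξ hξ => Shooting.W0_lt_traj h1 h2 (lt_trans hξ.2 hT'b))
    (by rw [hgerm a le_rfl]; exact RightL.above_of_far (by linarith [ShootingN.germ_anchor_far h1 h2]) hDWa)
    (θL RightL.rL) ⟨haθ.le, hθT'⟩
  rw [hθW] at key
  have hb := sL_spec.2.2.2.2.2
  show 0 < (Shooting.traj RightL.rL (θL RightL.rL)).2 - Zloc RightL.rL sL
  linarith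

set_option maxHeartbeats 400000 in
/-- **Continuity of `e` on the window.** [cite: BuckmasterCaolaboraGomezserrano2025, §6] -/
theorem continuousOn_eL : ContinuousOn eL (Icc RightL.rL RightM.rM) := by
  intro r0 hr0
  rw [Metric.continuousWithinAt_iff]
  intro ε hε
  obtain ⟨h1, h2, _, _, habs⟩ := windowL hr0
  obtain ⟨hab0, hgerm0, hode0, hΩ0, _, hanti0, _⟩ := Shooting.traj_spec h1 h2
  obtain ⟨haθ0, hθb0, hθW0⟩ := θL_spec hr0
  set a := ξA - 1 with ha
  set θ0 := θL r0 with hθ0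
  set f := Shooting.traj r0 with hf
  obtain ⟨T1, hθT1, hT1b⟩ := exists_between hθb0
  have haT1 : a ≤ T1 := by linarith
  -- Step 1: margins of `f` on `[a, T1]`
  have hfc : ContinuousOn f (Icc a T1) := fun u hu =>
    (hode0 u (lt_of_le_of_lt hu.2 hT1b)).continuousAt.continuousWithinAt
  have hcpt : IsCompact (Icc a T1) := isCompact_Icc
  have hne : (Icc a T1).Nonempty := nonempty_Icc.mpr haT1
  have hgc1 : ContinuousOn (fun u => DW (f u).1 (f u).2) (Icc a T1) := continuous_DW.comp_continuousOn hfc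
  have hgc2 : ContinuousOn (fun u => -DZ (f u).1 (f u).2) (Icc a T1) :=
    (continuous_DZ.comp_continuousOn hfc).neg
  obtain ⟨u1, hu1, hmin1⟩ := hcpt.exists_isMinOn hne hgc1
  obtain ⟨u2, hu2, hmin2⟩ := hcpt.exists_isMinOn hne hgc2
  set m := min (DW (f u1).1 (f u1).2) (-DZ (f u2).1 (f u2).2) / 2 with hm
  have hΩu1 := hΩ0 u1 (lt_of_le_of_lt hu1.2 hT1b)
  have hΩu2 := hΩ0 u2 (lt_of_le_of_lt hu2.2 hT1b)
  have hm0 : 0 < m := by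
    have : 0 < min (DW (f u1).1 (f u1).2) (-DZ (f u2).1 (f u2).2) :=
      lt_min hΩu1.1 (by linarith [hΩu2.2.1])
    simp only [hm]; linarith
  have hml1 : 2 * m ≤ DW (f u1).1 (f u1).2 := by
    have := min_le_left (DW (f u1).1 (f u1).2) (-DZ (f u2).1 (f u2).2); simp only [hm]; linarith
  have hml2 : 2 * m ≤ -DZ (f u2).1 (f u2).2 := by
    have := min_le_right (DW (f u1).1 (f u1).2) (-DZ (f u2).1 (f u2).2); simp only [hm]; linarith
  obtain ⟨C, hC⟩ := hcpt.exists_bound_of_continuousOn hfc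
  set R := max C 0 + 2 with hR
  have hR1 : 1 ≤ R := by simp only [hR]; linarith [le_max_right C 0]
  have hfs : ∀ u ∈ Icc a T1, 2 * m ≤ DW (f u).1 (f u).2 ∧ DZ (f u).1 (f u).2 ≤ -2 * m ∧
      |(f u).1| ≤ R - 1 ∧ |(f u).2| ≤ R - 1 := by
    intro u hu
    have h1' : DW (f u1).1 (f u1).2 ≤ DW (f u).1 (f u).2 := hmin1 hu
    have h2' : -DZ (f u2).1 (f u2).2 ≤ -DZ (f u).1 (f u).2 := hmin2 hu
    have hn := hC u hu
    have hn1 : |(f u).1| ≤ C := by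
      have := norm_fst_le (f u); rw [Real.norm_eq_abs] at this; exact this.trans hn
    have hn2 : |(f u).2| ≤ C := by
      have := norm_snd_le (f u); rw [Real.norm_eq_abs] at this; exact this.trans hn
    have hCR : C ≤ R - 1 := by simp only [hR]; linarith [le_max_left C 0]
    refine ⟨by linarith, by linarith, hn1.trans hCR, hn2.trans hCR⟩
  -- Step 2: localisation of the crossing time of `f`
  have hfθ : ContinuousAt f θ0 := (hode0 θ0 hθb0).continuousAt
  obtain ⟨ε1', hε1', hosc⟩ := Metric.continuousAt_iff.mp hfθ (ε / 3) (by positivity)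
  set ε1 := min (ε1' / 2) (min ((T1 - θ0) / 2) ((θ0 - a) / 2)) with hε1
  have hε10 : 0 < ε1 := by
    simp only [hε1]
    refine lt_min (by linarith) (lt_min (by linarith) (by linarith))
  have hε1a : ε1 < ε1' := lt_of_le_of_lt (min_le_left _ _) (by linarith)
  have hmr := min_le_right (ε1' / 2) (min ((T1 - θ0) / 2) ((θ0 - a) / 2))
  have hm1 := min_le_left ((T1 - θ0) / 2) ((θ0 - a) / 2)
  have hm2 := min_le_right ((T1 - θ0) / 2) ((θ0 - a) / 2)
  have hε1T : θ0 + ε1 < T1 := by simp only [hε1]; linarith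
  have hε1b : a < θ0 - ε1 := by simp only [hε1]; linarith
  have hmemm : θ0 - ε1 ∈ Iio (Shooting.bT r0) := show θ0 - ε1 < Shooting.bT r0 by linarith
  have hmemp : θ0 + ε1 ∈ Iio (Shooting.bT r0) := show θ0 + ε1 < Shooting.bT r0 by linarith
  have hWm : Wloc r0 sL < (f (θ0 - ε1)).1 := by
    rw [← hθW0]; exact hanti0 hmemm hθb0 (by linarith)
  have hWp : (f (θ0 + ε1)).1 < Wloc r0 sL := by
    rw [← hθW0]; exact hanti0 hθb0 hmemp (by linarith)
  set gap := min ((f (θ0 - ε1)).1 - Wloc r0 sL) (Wloc r0 sL - (f (θ0 + ε1)).1) with hgap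
  have hgap0 : 0 < gap := lt_min (by linarith) (by linarith)
  have hgap1 : gap ≤ (f (θ0 - ε1)).1 - Wloc r0 sL := min_le_left _ _
  have hgap2 : gap ≤ Wloc r0 sL - (f (θ0 + ε1)).1 := min_le_right _ _
  -- the closeness `η`
  set η := min (min m 1) (min (gap / 2) (ε / 3)) with hη
  have hη0 : 0 < η := lt_min (lt_min hm0 one_pos) (lt_min (by linarith) (by linarith))
  have hηm : η ≤ m := (min_le_left _ _).trans (min_le_left _ _)
  have hη1 : η ≤ 1 := (min_le_left _ _).trans (min_le_right _ _)
  have hηg : η ≤ gap / 2 := (min_le_right _ _).trans (min_le_left _ _)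
  have hηε : η ≤ ε / 3 := (min_le_right _ _).trans (min_le_right _ _)
  -- Step 3: the Grönwall bound is small for `r` near `r0`
  set K := Klip m R with hK
  have hK0 : 0 < K := Shooting.Klip_pos hm0 hR1
  set A := Real.exp (K * (T1 - a)) with hA
  have hA0 : 0 < A := Real.exp_pos _
  have hA1 : 1 ≤ A := Real.one_le_exp (by positivity)
  set B := (R / m) / K * (A - 1) with hB
  have hB0 : 0 ≤ B := by simp only [hB]; apply mul_nonneg (by positivity) (by linarith)
  -- initial data: continuity of the germ at `a`
  have hgc : ContinuousWithinAt (fun r => germ r a) (Icc (11 / 10) (28 / 25)) r0 :=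
    continuousOn_germ (by simp only [ha]; unfold ξA; norm_num) r0 ⟨h1, h2⟩
  obtain ⟨δg, hδg, hg⟩ := Metric.continuousWithinAt_iff.mp hgc (η / (2 * A)) (by positivity)
  -- the branch data at `sL`
  obtain ⟨_, _, hcW, hcZ, _⟩ := sL_spec
  obtain ⟨δW, hδW, hWc⟩ := Metric.continuousWithinAt_iff.mp (hcW r0 hr0) (gap / 2) (by positivity)
  obtain ⟨δZ, hδZ, hZc⟩ := Metric.continuousWithinAt_iff.mp (hcZ r0 hr0) (ε / 3) (by positivity)
  set δr := min (min δg (η / (2 * (B + 1)))) (min δW δZ) with hδr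
  have hδr0 : 0 < δr := lt_min (lt_min hδg (by positivity)) (lt_min hδW hδZ)
  refine ⟨δr, hδr0, fun r hr hdist => ?_⟩
  have hdg : dist r r0 < δg := lt_of_lt_of_le hdist ((min_le_left _ _).trans (min_le_left _ _))
  have hdB : dist r r0 < η / (2 * (B + 1)) := lt_of_lt_of_le hdist ((min_le_left _ _).trans (min_le_right _ _))
  have hdW : dist r r0 < δW := lt_of_lt_of_le hdist ((min_le_right _ _).trans (min_le_left _ _))
  have hdZ : dist r r0 < δZ := lt_of_lt_of_le hdist ((min_le_right _ _).trans (min_le_right _ _))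
  obtain ⟨k1, k2, _, _, _⟩ := windowL hr
  obtain ⟨hab, hgerm, hode, _, _, hanti, htend⟩ := Shooting.traj_spec k1 k2
  obtain ⟨_, hθb, hθW⟩ := θL_spec hr
  -- the initial distance and the perturbation
  have hδ0 : dist (f a) (Shooting.traj r a) < η / (2 * A) := by
    rw [hgerm0 a le_rfl, hgerm a le_rfl, dist_comm]; exact hg ⟨k1, k2⟩ hdg
  have hbound : gronwallBound (dist (f a) (Shooting.traj r a)) K (|r - r0| * (R / m)) (T1 - a) < η := by
    rw [gronwallBound_of_K_ne_0 hK0.ne']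
    show dist (f a) (Shooting.traj r a) * Real.exp (K * (T1 - a)) + |r - r0| * (R / m) / K * (Real.exp (K * (T1 - a)) - 1) < η
    rw [← hA]
    have e1 : |r - r0| * (R / m) / K * (A - 1) = |r - r0| * B := by simp only [hB]; ring
    rw [e1]
    have hrr : |r - r0| < η / (2 * (B + 1)) := by rw [← Real.dist_eq]; exact hdB
    have t1 : dist (f a) (Shooting.traj r a) * A < η / 2 := by
      have := (lt_div_iff₀ (by positivity : (0 : ℝ) < 2 * A)).mp hδ0
      linarith
    have t2 : |r - r0| * B ≤ η / 2 := by
      have hB1 : 0 < B + 1 := by linarith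
      calc |r - r0| * B ≤ η / (2 * (B + 1)) * B := by gcongr
        _ ≤ η / (2 * (B + 1)) * (B + 1) := by gcongr; linarith
        _ = η / 2 := by field_simp
    linarith
  -- the tube estimate
  obtain ⟨hT1g, hclose⟩ := tube_estimate (f := f) (g := Shooting.traj r) (P := (W0 r, Z0 r)) habs haT1 hT1b hab
    hode0 hode htend (DZ_Ps r) hm0 hR1 hη0 hηm hη1 hfs hbound
  have hclose' : ∀ u ∈ Icc a T1, dist (f u) (Shooting.traj r u) < η := fun u hu =>
    (hclose u hu).trans_lt ((gronwallBound_mono dist_nonneg (by positivity) hK0.le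
      (by linarith [hu.2] : u - a ≤ T1 - a)).trans_lt hbound)
  -- Step 4: the crossing time of `Shooting.traj r` is within `ε1` of `θ0`
  have hWr : |Wloc r sL - Wloc r0 sL| < gap / 2 := by rw [← Real.dist_eq]; exact hWc hr hdW
  have hZr : |Zloc r sL - Zloc r0 sL| < ε / 3 := by rw [← Real.dist_eq]; exact hZc hr hdZ
  obtain ⟨hWr1, hWr2⟩ := abs_lt.mp hWr
  have hcm := hclose' (θ0 - ε1) ⟨hε1b.le, by linarith⟩
  have hcp := hclose' (θ0 + ε1) ⟨by linarith, hε1T.le⟩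
  have hcm1 : |(f (θ0 - ε1)).1 - (Shooting.traj r (θ0 - ε1)).1| < η := by
    rw [← Real.dist_eq]; exact lt_of_le_of_lt (by rw [Prod.dist_eq]; exact le_max_left _ _) hcm
  have hcp1 : |(f (θ0 + ε1)).1 - (Shooting.traj r (θ0 + ε1)).1| < η := by
    rw [← Real.dist_eq]; exact lt_of_le_of_lt (by rw [Prod.dist_eq]; exact le_max_left _ _) hcp
  obtain ⟨hcm1a, hcm1b⟩ := abs_lt.mp hcm1
  obtain ⟨hcp1a, hcp1b⟩ := abs_lt.mp hcp1
  have hlt1 : (Shooting.traj r (θL r)).1 < (Shooting.traj r (θ0 - ε1)).1 := by rw [hθW]; linarith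
  have hlt2 : (Shooting.traj r (θ0 + ε1)).1 < (Shooting.traj r (θL r)).1 := by rw [hθW]; linarith
  have hm_r : θ0 - ε1 ∈ Iio (Shooting.bT r) := show θ0 - ε1 < Shooting.bT r by linarith
  have hp_r : θ0 + ε1 ∈ Iio (Shooting.bT r) := show θ0 + ε1 < Shooting.bT r by linarith
  have hθ1 : θ0 - ε1 < θL r := (StrictAntiOn.lt_iff_gt hanti hθb hm_r).mp hlt1
  have hθ2 : θL r < θ0 + ε1 := (StrictAntiOn.lt_iff_gt hanti hp_r hθb).mp hlt2
  -- Step 5: the estimate of `eL r - e r0`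
  have hθmem : θL r ∈ Icc a T1 := ⟨by linarith, by linarith⟩
  have hd1 : |(Shooting.traj r (θL r)).2 - (f (θL r)).2| < η := by
    rw [← Real.dist_eq, dist_comm]
    exact lt_of_le_of_lt (by rw [Prod.dist_eq]; exact le_max_right _ _) (hclose' _ hθmem)
  have hd2 : |(f (θL r)).2 - (f θ0).2| < ε / 3 := by
    have hdθ : dist (θL r) θ0 < ε1' := by
      rw [Real.dist_eq, abs_lt]; constructor <;> linarith
    have := hosc hdθ
    rw [← Real.dist_eq]
    exact lt_of_le_of_lt (by rw [Prod.dist_eq]; exact le_max_right _ _) this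
  obtain ⟨hd1a, hd1b⟩ := abs_lt.mp hd1
  obtain ⟨hd2a, hd2b⟩ := abs_lt.mp hd2
  obtain ⟨hZr1, hZr2⟩ := abs_lt.mp hZr
  rw [Real.dist_eq, abs_lt]
  unfold eL
  constructor <;> linarith

/-- **The shooting succeeds**: for some `r ∈ [r_L, 697/625]` the `P₀` trajectory meets the branch through
`P_s` at the branch time `s₀ < 0`. [cite: BuckmasterCaolaboraGomezserrano2025, §6 (proof of Theorem 1.1)] -/
theorem exists_meetingL : ∃ r ∈ Icc RightL.rL RightM.rM, Shooting.traj r (θL r) = (Wloc r sL, Zloc r sL) := by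
  have h := intermediate_value_Icc' rlo_le_rhi continuousOn_eL ⟨eL_rhi_neg.le, eL_rlo_pos.le⟩
  obtain ⟨r, hr, her⟩ := h
  refine ⟨r, hr, Prod.ext (θL_spec hr).2.2 ?_⟩
  unfold eL at her
  show (Shooting.traj r (θL r)).2 = Zloc r sL
  linarith

end ShootingL

end Monatomic

end BuckmasterCaolaboraGomezserrano2025

end Literature.Analysis.FluidPDE
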